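import Mathlib.LinearAlgebra.Matrix.ToLinearEquiv
import Mathlib.LinearAlgebra.LinearIndependent.Lemmas
import Mathlib.LinearAlgebra.FiniteDimensional.Lemmas
import Mathlib.LinearAlgebra.Matrix.Nondegenerate
import Literature.RingTheory.MvPolynomial.RuppertMinorsProofs
import Literature.RingTheory.MvPolynomial.RuppertGaoKernel
import HarnessLib

/-!
# The Gao–Ruppert kernel theorem in rank form: the number of factors versus the minors

Continues `RuppertMinorsProofs.lean` (the dictionary between kernel pairs of Ruppert's map `R_φ`
and the minors `rupMinor d φ r c` of Ruppert's matrix, there for one and two kernel pairs) and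
`RuppertGaoKernel.lean` (the kernel is spanned by the factor pairs). Sources: S. Gao, Math. Comp.
72 (2003) 801–822, Thm. 2.3 ("`dim G = r`, the number of absolutely irreducible factors");
W. M. Ruppert, J. Number Theory 77 (1999) 62–70, §2 ("`M(f)` has rank … i.e. all submatrices …
vanish" / "there is a submatrix `M₀` with `det M₀ ≠ 0`"). With `N = |Col d|` the number of
unknowns:

* `Ruppert.rupMinor_eq_zero_of_kernel_pairs` — `r` linearly independent kernel pairs in the box
  kill every minor of size `m` with `m + r > N` (linear algebra);
* `Ruppert.exists_rupMinor_ne_zero_of_kernel_subset_span` — if every kernel pair in the box is a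
  combination of `r` independent pairs, some minor of size `N − r` is non-zero;
* `Ruppert.card_add_le_of_rupMinor_ne_zero` — **upper bound for the number of factors** over any
  field in which `1, …, d` are non-zero: if `φ ≠ 0`, `deg φ ≤ d`, has `r` pairwise non-associated
  irreducible factors and a non-zero minor of size `m`, then `r + m ≤ N`;
* `Ruppert.exists_rupMinor_ne_zero_of_prod` — **the rank is attained** over an algebraically
  closed field of characteristic zero: for `φ = c · w₁ ⋯ w_r` squarefree of degree `d ≥ 1` some
  minor of size `N − r` is non-zero (Gao's `dim ker R_φ = r`).

No definitions, no named facts; helpers private.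

## References

* S. Gao, Math. Comp. 72 (2003) 801–822, Thm. 2.3. [`GaoPDE2003`]
* W. M. Ruppert, J. Number Theory 77 (1999) 62–70, §2. [`Ruppert1999`]
-/

noncomputable section

open MvPolynomial

namespace Literature.RingTheory.MvPolynomial

namespace Ruppert

variable {F : Type*} [Field F]

/-! ### `r` independent kernel pairs kill the minors of size `> N − r` -/

/-- **Independent kernel pairs kill the large minors**: `r` linearly independent kernel pairs of
`R_φ` in the box force every minor of size `m` with `N < m + r` to vanish ("equation (1) has `r`
independent solutions iff `M(f)` has rank `≤ N − r`"). [cite: Ruppert1999, §2] -/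
theorem rupMinor_eq_zero_of_kernel_pairs {d r : ℕ} {φ : MvPolynomial (Fin 2) F}
    (G H : Fin r → MvPolynomial (Fin 2) F) (hG : ∀ j, (G j).totalDegree ≤ d - 1)
    (hH : ∀ j, (H j).totalDegree ≤ d - 1) (hR : ∀ j, rupOp φ (G j) (H j) = 0)
    (hind : ∀ a : Fin r → F, ∑ j, a j • G j = 0 → ∑ j, a j • H j = 0 → ∀ j, a j = 0)
    {m : ℕ} (hm : Fintype.card (Col d) < m + r) (rows : Fin m → (Fin 2 →₀ ℕ))
    (c : Fin m → Col d) : rupMinor d φ rows c = 0 := by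
  classical
  -- coefficient vectors of the kernel pairs
  set x : Fin r → Col d → F := fun j => pairVec d (G j) (H j) with hx
  have hxker : ∀ j e', ∑ col : Col d, rupMat d φ e' col * x j col = 0 := fun j e' =>
    sum_rupMat_pairVec_eq_zero (hG j) (hH j) (hR j) e'
  have hxind : ∀ a : Fin r → F, ∑ j, a j • x j = 0 → ∀ j, a j = 0 := by
    intro a ha
    have hvec : pairVec d (∑ j, a j • G j) (∑ j, a j • H j) = 0 := by
      rw [← ha]
      funext col
      simp only [pairVec, Finset.sum_apply, Pi.smul_apply, smul_eq_mul, coeff_sum, coeff_smul, x]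
      split_ifs <;> rfl
    have hdegG : (∑ j, a j • G j).totalDegree ≤ d - 1 :=
      (totalDegree_finsetSum _ _).trans (Finset.sup_le fun j _ => (totalDegree_smul_le _ _).trans (hG j))
    have hdegH : (∑ j, a j • H j).totalDegree ≤ d - 1 :=
      (totalDegree_finsetSum _ _).trans (Finset.sup_le fun j _ => (totalDegree_smul_le _ _).trans (hH j))
    obtain ⟨h1, h2⟩ := eq_zero_of_pairVec_eq_zero hdegG hdegH hvec
    exact hind a h1 h2
  unfold rupMinor
  -- non-injective column selections have two equal columns
  by_cases hc : Function.Injective c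
  swap
  · obtain ⟨j₁, j₂, hj, hne⟩ : ∃ j₁ j₂, c j₁ = c j₂ ∧ j₁ ≠ j₂ := by
      unfold Function.Injective at hc; push Not at hc
      obtain ⟨a, b, hab, hne⟩ := hc; exact ⟨a, b, hab, hne⟩
    exact Matrix.det_zero_of_column_eq hne (fun i => by simp [hj])
  -- the complement of the selected columns has fewer than `r` elements
  have hcardT : Fintype.card {col : Col d // col ∉ Set.range c} < r := by
    have h1 := Fintype.card_subtype_compl (fun col : Col d => col ∈ Set.range c)
    have h2 : Fintype.card {col : Col d // col ∈ Set.range c} = m := by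
      rw [Fintype.card_of_subtype (Finset.univ.image c) (fun col => by simp [eq_comm]),
        Finset.card_image_of_injective _ hc, Finset.card_univ, Fintype.card_fin]
    have h3 : m ≤ Fintype.card (Col d) := by
      simpa using Fintype.card_le_of_injective c hc
    omega
  -- a non-trivial combination of the `x_j` vanishing outside the selected columns
  let Φ : (Fin r → F) →ₗ[F] ({col : Col d // col ∉ Set.range c} → F) :=
    { toFun := fun a t => ∑ j, a j * x j t.1
      map_add' := fun a b => by
        funext t; simp only [Pi.add_apply, add_mul, Finset.sum_add_distrib]
      map_smul' := fun s a => by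
        funext t; simp only [Pi.smul_apply, smul_eq_mul, RingHom.id_apply, Finset.mul_sum, mul_assoc] }
  have hker : LinearMap.ker Φ ≠ ⊥ := by
    refine LinearMap.ker_ne_bot_of_finrank_lt ?_
    simpa using hcardT
  obtain ⟨a, ha, ha0⟩ : ∃ a ∈ LinearMap.ker Φ, a ≠ 0 := Submodule.exists_mem_ne_zero_of_ne_bot hker
  set z : Col d → F := ∑ j, a j • x j with hz
  have hz0 : z ≠ 0 := by
    intro h
    apply ha0
    funext j
    exact hxind a h j
  have hzT : ∀ col, col ∉ Set.range c → z col = 0 := by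
    intro col hcol
    have := congrFun (LinearMap.mem_ker.mp ha) ⟨col, hcol⟩
    simpa [Φ, hz, Finset.sum_apply, Pi.smul_apply, smul_eq_mul] using this
  have hzker : ∀ e', ∑ col : Col d, rupMat d φ e' col * z col = 0 := by
    intro e'
    simp only [hz, Finset.sum_apply, Pi.smul_apply, smul_eq_mul, Finset.mul_sum]
    rw [Finset.sum_comm]
    refine Finset.sum_eq_zero fun j _ => ?_
    have : ∑ col : Col d, rupMat d φ e' col * (a j * x j col) = a j * ∑ col, rupMat d φ e' col * x j col := by
      rw [Finset.mul_sum]; exact Finset.sum_congr rfl fun _ _ => by ring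
    rw [this, hxker, mul_zero]
  -- transport to the square submatrix
  refine (Matrix.exists_mulVec_eq_zero_iff).mp ⟨z ∘ c, ?_, ?_⟩
  · intro hzc
    apply hz0
    funext col
    by_cases hcol : col ∈ Set.range c
    · obtain ⟨i, rfl⟩ := hcol
      exact congrFun hzc i
    · exact hzT col hcol
  · funext i
    rw [Matrix.mulVec, Pi.zero_apply]
    change ∑ l, rupMat d φ (rows i) (c l) * z (c l) = 0
    rw [← hzker (rows i)]
    rw [← Finset.sum_image (f := fun col => rupMat d φ (rows i) col * z col)
      (fun a _ b _ hab => hc hab)]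
    refine Finset.sum_subset (Finset.subset_univ _) fun col _ hcol => ?_
    rw [hzT col (by simpa [Set.mem_range, eq_comm] using hcol), mul_zero]

/-! ### A kernel of dimension `r` gives a non-zero minor of size `N − r` -/

/-- **A kernel spanned by `r` independent pairs gives a non-zero minor of size `N − r`.** If the
pairs `(P_j, Q_j)`, `j < r`, in the box are linearly independent and every kernel pair of `R_φ`
in the box is an `F`-combination of them, then some minor of Ruppert's matrix of size `N − r` is
non-zero ("there is a submatrix `M₀` with `det M₀ ≠ 0`"). [cite: Ruppert1999, §2] -/
theorem exists_rupMinor_ne_zero_of_kernel_subset_span {d r : ℕ} {φ : MvPolynomial (Fin 2) F}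
    (hφ : φ.totalDegree ≤ d) (P Q : Fin r → MvPolynomial (Fin 2) F)
    (hP : ∀ j, (P j).totalDegree ≤ d - 1) (hQ : ∀ j, (Q j).totalDegree ≤ d - 1)
    (hind : ∀ a : Fin r → F, ∑ j, a j • P j = 0 → ∑ j, a j • Q j = 0 → ∀ j, a j = 0)
    (hker : ∀ G H : MvPolynomial (Fin 2) F, G.totalDegree ≤ d - 1 → H.totalDegree ≤ d - 1 →
      rupOp φ G H = 0 → ∃ a : Fin r → F, G = ∑ j, a j • P j ∧ H = ∑ j, a j • Q j) :
    ∃ (k : ℕ) (_ : k + r = Fintype.card (Col d)) (rows : Fin k → (Fin 2 →₀ ℕ)) (c : Fin k → Col d),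
      rupMinor d φ rows c ≠ 0 := by
  classical
  set N := Fintype.card (Col d) with hN
  -- coefficient vectors of the spanning pairs; an invertible `r × r` block `J`
  set x : Fin r → Col d → F := fun j => pairVec d (P j) (Q j) with hx
  have hxind : LinearIndependent F x := by
    rw [Fintype.linearIndependent_iff]
    intro a ha
    have hvec : pairVec d (∑ j, a j • P j) (∑ j, a j • Q j) = 0 := by
      rw [← ha]
      funext col
      simp only [pairVec, Finset.sum_apply, Pi.smul_apply, smul_eq_mul, coeff_sum, coeff_smul, x]
      split_ifs <;> rfl
    have hdegP : (∑ j, a j • P j).totalDegree ≤ d - 1 :=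
      (totalDegree_finsetSum _ _).trans (Finset.sup_le fun j _ => (totalDegree_smul_le _ _).trans (hP j))
    have hdegQ : (∑ j, a j • Q j).totalDegree ≤ d - 1 :=
      (totalDegree_finsetSum _ _).trans (Finset.sup_le fun j _ => (totalDegree_smul_le _ _).trans (hQ j))
    obtain ⟨h1, h2⟩ := eq_zero_of_pairVec_eq_zero hdegP hdegQ hvec
    exact hind a h1 h2
  obtain ⟨J, hJ⟩ := exists_rows_det_ne_zero r x hxind
  have hJinj : Function.Injective J := by
    intro i₁ i₂ h
    by_contra hne
    exact hJ (Matrix.det_zero_of_row_eq hne (funext fun j => by simp [h]))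
  have hrN : r ≤ N := by simpa [hN] using Fintype.card_le_of_injective J hJinj
  -- enumerate the columns outside `J`
  have hcardc : Fintype.card {col : Col d // col ∉ Set.range J} = N - r := by
    have h1 := Fintype.card_subtype_compl (fun col : Col d => col ∈ Set.range J)
    have h2 : Fintype.card {col : Col d // col ∈ Set.range J} = r := by
      rw [Fintype.card_of_subtype (Finset.univ.image J) (fun col => by simp [eq_comm]),
        Finset.card_image_of_injective _ hJinj, Finset.card_univ, Fintype.card_fin]
    omega
  let ec : Fin (N - r) ≃ {col : Col d // col ∉ Set.range J} := (Fintype.equivFinOfCardEq hcardc).symm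
  let c : Fin (N - r) → Col d := fun i => (ec i).1
  have hc : Function.Injective c := fun a b hab => ec.injective (Subtype.ext hab)
  have hcJ : ∀ i, c i ∉ Set.range J := fun i => (ec i).2
  -- the columns outside `J`, on the finite row set `box (2d)`, are independent
  let b : Fin (N - r) → box (2 * d) → F := fun j e' => rupMat d φ e'.1 (c j)
  have hb : LinearIndependent F b := by
    rw [Fintype.linearIndependent_iff]
    intro y hy
    -- extend `y` by zero on `J`
    let z : Col d → F := fun col => if h : col ∈ Set.range J then 0 else y (ec.symm ⟨col, h⟩)
    have hzc : ∀ i, z (c i) = y i := by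
      intro i
      simp only [z, dif_neg (hcJ i)]
      congr 1
      have : (⟨c i, hcJ i⟩ : {col : Col d // col ∉ Set.range J}) = ec i := Subtype.ext rfl
      rw [this, Equiv.symm_apply_apply]
    have hzJ : ∀ i, z (J i) = 0 := fun i => by simp [z]
    -- the pair with coefficient vector `z` is a kernel pair
    set G := (vecPair d z).1 with hG
    set H := (vecPair d z).2 with hH
    have hdegs := totalDegree_vecPair_le d z
    have hcoeff : ∀ e', coeff e' (rupOp φ G H) = ∑ col : Col d, rupMat d φ e' col * z col :=
      fun e' => coeff_rupOp_vecPair d φ z e'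
    have hsum : ∀ e', ∑ col : Col d, rupMat d φ e' col * z col =
        ∑ i : Fin (N - r), rupMat d φ e' (c i) * y i := by
      intro e'
      have : ∑ col : Col d, rupMat d φ e' col * z col =
          ∑ col ∈ Finset.univ.image c, rupMat d φ e' col * z col := by
        refine (Finset.sum_subset (Finset.subset_univ _) fun col _ hcol => ?_).symm
        have hmem : col ∈ Set.range J := by
          by_contra h
          apply hcol
          refine Finset.mem_image.mpr ⟨ec.symm ⟨col, h⟩, Finset.mem_univ _, ?_⟩
          simp [c]
        obtain ⟨i, rfl⟩ := hmem
        rw [hzJ, mul_zero]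
      rw [this, Finset.sum_image (fun a _ b _ hab => hc hab)]
      exact Finset.sum_congr rfl fun i _ => by rw [hzc]
    have hR : rupOp φ G H = 0 := by
      ext e'
      rw [coeff_zero, hcoeff, hsum]
      by_cases he' : e' ∈ box (2 * d)
      · have := congrFun hy ⟨e', he'⟩
        simpa [b, Finset.sum_apply, Pi.smul_apply, smul_eq_mul, mul_comm] using this
      · have hzero : ∀ col : Col d, rupMat d φ e' col = 0 := by
          intro col
          unfold rupMat
          have hdeg : (rupOp φ (colPair d col).1 (colPair d col).2).totalDegree ≤ 2 * d := by
            refine totalDegree_rupOp_le hφ ?_ ?_ <;>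
            · unfold colPair; split_ifs <;>
                first
                | exact (totalDegree_monomial_le _ _).trans (mem_box.mp col.2.2)
                | simp
          by_contra hne
          exact he' (support_subset_box hdeg (mem_support_iff.mpr hne))
        simp [hzero]
    obtain ⟨a, hGa, hHa⟩ := hker G H hdegs.1 hdegs.2 hR
    -- hence `z = Σ a_j x_j`; on `J` this forces `a = 0`
    have hzx : z = ∑ j, a j • x j := by
      have h1 : pairVec d G H = z := pairVec_vecPair d z
      rw [← h1, hGa, hHa]
      funext col
      simp only [pairVec, Finset.sum_apply, Pi.smul_apply, smul_eq_mul, coeff_sum, coeff_smul, x]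
      split_ifs <;> rfl
    have ha : a = 0 := by
      refine Matrix.eq_zero_of_mulVec_eq_zero hJ ?_
      funext i
      rw [Matrix.mulVec, Pi.zero_apply]
      change ∑ j, x j (J i) * a j = 0
      have := congrFun hzx (J i)
      rw [hzJ, Finset.sum_apply] at this
      rw [this]
      exact Finset.sum_congr rfl fun j _ => by rw [Pi.smul_apply, smul_eq_mul, mul_comm]
    intro i
    rw [← hzc i, hzx, ha]
    simp
  obtain ⟨rows, hrows⟩ := exists_rows_det_ne_zero (N - r) b hb
  exact ⟨N - r, by omega, fun i => (rows i).1, c, hrows⟩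

/-! ### The number of factors versus the minors -/

/-- **Upper bound for the number of factors by a non-zero minor** (any field in which `1, …, d`
are non-zero): if `φ ≠ 0`, `deg φ ≤ d`, has `r` pairwise non-associated irreducible factors
`w_j` and some minor of Ruppert's matrix of size `m` is non-zero, then `r + m ≤ N`. (The `r`
factor pairs are independent kernel pairs.) [cite: GaoPDE2003, Thm. 2.3] -/
theorem card_add_le_of_rupMinor_ne_zero {d r : ℕ} (hchar : ∀ a : ℕ, 0 < a → a ≤ d → (a : F) ≠ 0)
    {φ : MvPolynomial (Fin 2) F} (hφ0 : φ ≠ 0) (hφd : φ.totalDegree ≤ d)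
    (w : Fin r → MvPolynomial (Fin 2) F) (hw : ∀ j, Irreducible (w j)) (hdvd : ∀ j, w j ∣ φ)
    (hna : ∀ j k, j ≠ k → ¬ w j ∣ w k) {m : ℕ} {rows : Fin m → (Fin 2 →₀ ℕ)} {c : Fin m → Col d}
    (hmin : rupMinor d φ rows c ≠ 0) : r + m ≤ Fintype.card (Col d) := by
  classical
  by_contra hlt
  push Not at hlt
  choose t ht using hdvd
  have hgrad : ∀ j, pderiv 0 (w j) ≠ 0 ∨ pderiv 1 (w j) ≠ 0 := by
    intro j
    have hwj0 : w j ≠ 0 := (hw j).ne_zero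
    have hpos : 0 < (w j).totalDegree := by
      by_contra h0
      have h0' : (w j).totalDegree = 0 := by omega
      by_cases hcf : coeff 0 (w j) = 0
      · apply hwj0
        rw [totalDegree_eq_zero_iff_eq_C] at h0'
        rw [h0', hcf, C_0]
      · exact (hw j).not_isUnit (MvPolynomial.isUnit_iff_totalDegree_of_isReduced.mpr
          ⟨(Ne.isUnit hcf), h0'⟩)
    have hle : (w j).totalDegree ≤ d :=
      (totalDegree_le_of_dvd_of_isDomain ⟨t j, ht j⟩ hφ0).trans hφd
    exact pderiv_ne_zero_of_totalDegree_pos hchar hpos hle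
  refine hmin (rupMinor_eq_zero_of_kernel_pairs
    (fun j => t j * pderiv 0 (w j)) (fun j => t j * pderiv 1 (w j))
    (fun j => (totalDegree_factorPair_le (ht j) hφ0 0).trans (Nat.sub_le_sub_right hφd 1))
    (fun j => (totalDegree_factorPair_le (ht j) hφ0 1).trans (Nat.sub_le_sub_right hφd 1))
    (fun j => rupOp_factorPair (ht j))
    (factorPairs_independent hφ0 w t hw ht hna hgrad) (by omega) rows c)

/-- **The rank is attained (Gao's `dim ker R_φ = r`)**: over an algebraically closed field of
characteristic zero, for `φ = c · w₀ ⋯ w_{r−1}` with `c ≠ 0`, `w_j` pairwise non-associated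
irreducible, of degree `d ≥ 1`, some minor of Ruppert's matrix of size `N − r` is non-zero (and
`r ≤ N`). [cite: GaoPDE2003, Thm. 2.3] -/
theorem exists_rupMinor_ne_zero_of_prod [IsAlgClosed F] [CharZero F] {d r : ℕ}
    {φ : MvPolynomial (Fin 2) F} (hdeg : φ.totalDegree = d) (hd : 1 ≤ d) {c : F} (hc : c ≠ 0)
    (w : Fin r → MvPolynomial (Fin 2) F) (hw : ∀ j, Irreducible (w j))
    (hna : ∀ j k, j ≠ k → ¬ w j ∣ w k) (hφ : φ = C c * ∏ j, w j) :
    ∃ (k : ℕ) (_ : k + r = Fintype.card (Col d)) (rows : Fin k → (Fin 2 →₀ ℕ)) (cs : Fin k → Col d),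
      rupMinor d φ rows cs ≠ 0 := by
  classical
  have hφ0 : φ ≠ 0 := by
    intro h; rw [h, totalDegree_zero] at hdeg; omega
  set ψ : Fin r → MvPolynomial (Fin 2) F := fun j => C c * ∏ k ∈ Finset.univ.erase j, w k with hψ
  have hφj : ∀ j, φ = w j * ψ j := by
    intro j
    rw [hφ, hψ]
    simp only
    rw [mul_left_comm, Finset.mul_prod_erase _ _ (Finset.mem_univ j)]
  have hgrad : ∀ j, pderiv 0 (w j) ≠ 0 ∨ pderiv 1 (w j) ≠ 0 := by
    intro j
    have hpos : 0 < (w j).totalDegree := by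
      by_contra h0
      have h0' : (w j).totalDegree = 0 := by omega
      by_cases hcf : coeff 0 (w j) = 0
      · apply (hw j).ne_zero
        rw [totalDegree_eq_zero_iff_eq_C] at h0'
        rw [h0', hcf, C_0]
      · exact (hw j).not_isUnit (MvPolynomial.isUnit_iff_totalDegree_of_isReduced.mpr
          ⟨(Ne.isUnit hcf), h0'⟩)
    by_contra h
    push Not at h
    rcases not_dvd_pderiv_or hpos with h1 | h1
    · exact h1 (by rw [h.1]; exact dvd_zero _)
    · exact h1 (by rw [h.2]; exact dvd_zero _)
  exact exists_rupMinor_ne_zero_of_kernel_subset_span hdeg.le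
    (fun j => ψ j * pderiv 0 (w j)) (fun j => ψ j * pderiv 1 (w j))
    (fun j => hdeg ▸ totalDegree_factorPair_le (hφj j) hφ0 0)
    (fun j => hdeg ▸ totalDegree_factorPair_le (hφj j) hφ0 1)
    (factorPairs_independent hφ0 w ψ hw hφj hna hgrad)
    (fun G H hG hH hR => kernel_subset_span_factorPairs hdeg hd hc w hw hna hφ hG hH hR)

end Ruppert

end Literature.RingTheory.MvPolynomial

end
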